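import Mathlib
import Literature.AlgebraicGeometry.Resolution.KummerNormalForm
import Literature.AlgebraicGeometry.Resolution.NormalizationOfVarietiesProofs
import Summits.ResolutionOfSingularities.ResolutionOfSingularities.Theorems.PicoverLocalModel.Negative.PowerDichotomy

/-!
# Crux `PicoverLocalModel` (stmt-ResolutionOfSingularities-0557), line `SketchIdeator3`
# (giraud-cossart-normal-form) — stub `stub_badLocusFinite`

For `R` a regular finitely generated `k`-domain of Krull dimension `≤ 1` (`char k = p`) and
`a ∈ R ∖ R^p`, the set of primes `q` of `R` at which the image of `a` in `R_q` is NOT in Giraud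
normal form with empty boundary (`GiraudNormalFormAt p ![] a`) is finite and consists of non-zero
primes.

Proof. (1) If `a - c^p ∉ 𝔪_q²` for every `c ∈ R_q` then `a` is in Giraud normal form at `q`
(`g = 0`, `u = a`: wound if `a - c^p ∉ 𝔪_q` for all `c`, transversal otherwise); so at a bad
prime `a ≡ c^p (mod 𝔪_q²)` for some `c ∈ R_q`. (2) At `q = ⊥`, `𝔪_q = 0` and `a` would be a
`p`-th power in `Frac R` — excluded since `R` is normal. (3) At a bad closed point `q` (`R_q` is a
DVR; take a uniformizer `ϖ ∈ R`), clearing denominators gives `t₂ (t₁^p a - c^p) = t₁^p ϖ² e` in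
`R` with `t₁, t₂ ∉ q`. In `L = Frac(R)[T]/(T^p - a) ∋ α`, the element
`γ = t₂ (t₁ α - c)^{p-1} / ϖ` has `γ^p ∈ R`, so it lies in the integral closure `R'` of `R` in
`L`, a finite `R`-module by E. Noether (`NoetherFiniteIntegralClosure_holds`); a non-zero
`s₀ ∈ R` multiplies `R'` into `R[α]`, whose elements have all coordinates (coefficients of the
reduced representative modulo `T^p - a`) in `R`; the `α^{p-1}`-coordinate of `s₀ γ` is
`s₀ t₂ t₁^{p-1} / ϖ`, forcing `s₀ ∈ q`. (4) The primes `q ∋ s₀`, `q ≠ ⊥`, are minimal over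
`(s₀)`: a finite set (`R` Noetherian).
-/

noncomputable section

set_option linter.dupNamespace false

open CategoryTheory AlgebraicGeometry Polynomial Literature.AlgebraicGeometry.Resolution

namespace Summit.ResolutionOfSingularities.ResolutionOfSingularities.Theorems.PicoverLocalModel.BadLocusFinite

/-! ## The local criterion with empty boundary -/

/-- In a local ring, if `a - c^p ∉ 𝔪²` for every `c`, then `a` is in Giraud normal form with
empty boundary: `a = 0^p + 1^p · a` with `u = a` wound (`a - c^p ∉ 𝔪` for all `c`) or
transversal (`a - c^p ∈ 𝔪 ∖ 𝔪²` for some `c`). [folklore] -/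
theorem giraudNormalFormAt_empty_of_forall_notMem_sq {O : Type*} [CommRing O] [IsLocalRing O]
    {p : ℕ} (hp : p ≠ 0) (a : O) (h : ∀ c : O, a - c ^ p ∉ IsLocalRing.maximalIdeal O ^ 2) :
    GiraudNormalFormAt p (![] : Fin 0 → O) a := by
  have ha : a = 0 ^ p + (∏ j : Fin 0, (![] : Fin 0 → O) j ^ (![] : Fin 0 → ℕ) j) ^ p * a := by
    simp [zero_pow hp]
  by_cases hc : ∃ c : O, a - c ^ p ∈ IsLocalRing.maximalIdeal O
  · obtain ⟨c, hc⟩ := hc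
    refine Or.inl ⟨0, a, ![], Or.inr ⟨c, hc, ?_⟩, ha⟩
    rw [Set.range_eq_empty, Ideal.span_empty, sup_bot_eq]
    exact h c
  · exact Or.inl ⟨0, a, ![], Or.inl fun c hc' => hc ⟨c, hc'⟩, ha⟩

/-- At a point where Giraud normal form with empty boundary fails, `a ≡ c^p (mod 𝔪²)` for some
`c`. [folklore] -/
theorem exists_sub_pow_mem_sq_of_not_giraudNormalFormAt {O : Type*} [CommRing O]
    [IsLocalRing O] {p : ℕ} (hp : p ≠ 0) {a : O}
    (h : ¬ GiraudNormalFormAt p (![] : Fin 0 → O) a) :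
    ∃ c : O, a - c ^ p ∈ IsLocalRing.maximalIdeal O ^ 2 := by
  by_contra hc
  exact h (giraudNormalFormAt_empty_of_forall_notMem_sq hp a fun c hc' => hc ⟨c, hc'⟩)

/-- Clearing denominators at a prime `q`: if `a ≡ c^p (mod 𝔪_q²)` in `R_q` and `𝔪_q` is
generated by the image of `ϖ ∈ R`, then `t₂ (t₁^p a - c₀^p) = t₁^p ϖ² e₀` in `R` for some
`c₀ e₀ ∈ R` and `t₁, t₂ ∉ q`. [folklore] -/
theorem exists_eq_of_sub_pow_mem_sq {R : Type*} [CommRing R] [IsDomain R] (q : Ideal R)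
    [q.IsPrime] (p : ℕ) (a ϖ : R)
    (hϖ : IsLocalRing.maximalIdeal (Localization.AtPrime q) =
      Ideal.span {algebraMap R (Localization.AtPrime q) ϖ})
    (h : ∃ c : Localization.AtPrime q, algebraMap R _ a - c ^ p ∈
      IsLocalRing.maximalIdeal (Localization.AtPrime q) ^ 2) :
    ∃ c₀ e₀ t₁ t₂ : R, t₁ ∉ q ∧ t₂ ∉ q ∧
      t₂ * (t₁ ^ p * a - c₀ ^ p) = t₁ ^ p * ϖ ^ 2 * e₀ := by
  obtain ⟨c, hc⟩ := h
  rw [hϖ, Ideal.span_singleton_pow, Ideal.mem_span_singleton] at hc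
  obtain ⟨e, he⟩ := hc
  obtain ⟨c₀, t₁, hc⟩ : ∃ (c₀ : R) (t₁ : q.primeCompl),
      c * algebraMap R _ t₁ = algebraMap R _ c₀ :=
    let ⟨x, hx⟩ := IsLocalization.surj q.primeCompl c; ⟨x.1, x.2, hx⟩
  obtain ⟨e₀, t₂, he₀⟩ : ∃ (e₀ : R) (t₂ : q.primeCompl),
      e * algebraMap R _ t₂ = algebraMap R _ e₀ :=
    let ⟨x, hx⟩ := IsLocalization.surj q.primeCompl e; ⟨x.1, x.2, hx⟩
  refine ⟨c₀, e₀, t₁, t₂, t₁.2, t₂.2, ?_⟩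
  apply IsLocalization.injective (Localization.AtPrime q) q.primeCompl_le_nonZeroDivisors
  simp only [map_mul, map_sub, map_pow]
  rw [← hc, ← he₀]
  linear_combination (algebraMap R (Localization.AtPrime q) (t₁ : R)) ^ p *
    algebraMap R (Localization.AtPrime q) (t₂ : R) * he

/-! ## The order `R[α] ⊆ L = Frac(R)[T]/(f)` and its conductor -/

section Order

variable {R K : Type*} [CommRing R] [IsDomain R] [Field K] [Algebra R K] [IsFractionRing R K]

/-- Every element of `K[T]/(f)`, `K = Frac R`, has a non-zero `R`-multiple in `R[root f]`
(clear the denominators of a representative). [folklore] -/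
theorem exists_smul_mem_adjoin_root (f : K[X]) (y : AdjoinRoot f) :
    ∃ b : R, b ≠ 0 ∧ b • y ∈ Algebra.adjoin R {AdjoinRoot.root f} := by
  induction y using AdjoinRoot.induction_on with
  | ih g =>
    obtain ⟨b, hb, hbg⟩ := IsLocalization.integerNormalization_spec (nonZeroDivisors R) g
    refine ⟨b, nonZeroDivisors.ne_zero hb, ?_⟩
    rw [Algebra.adjoin_singleton_eq_range_aeval, AlgHom.mem_range]
    refine ⟨IsLocalization.integerNormalization (nonZeroDivisors R) g, ?_⟩
    rw [AdjoinRoot.aeval_eq_of_algebra, hbg, AdjoinRoot.smul_mk]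

/-- A finitely generated `R`-submodule of `K[T]/(f)` is carried into `R[root f]` by ONE
non-zero element of `R`. [folklore] -/
theorem exists_smul_mem_adjoin_root_of_fg (f : K[X]) {M : Submodule R (AdjoinRoot f)}
    (hM : M.FG) : ∃ s : R, s ≠ 0 ∧ ∀ y ∈ M, s • y ∈ Algebra.adjoin R {AdjoinRoot.root f} := by
  classical
  obtain ⟨S, rfl⟩ := hM
  choose b hb0 hb using exists_smul_mem_adjoin_root (R := R) f
  refine ⟨∏ y ∈ S, b y, Finset.prod_ne_zero_iff.mpr fun y _ => hb0 y, fun y hy => ?_⟩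
  refine Submodule.span_induction
    (p := fun y _ => (∏ y ∈ S, b y) • y ∈ Algebra.adjoin R {AdjoinRoot.root f}) ?_ ?_ ?_ ?_ hy
  · intro y hyS
    rw [← Finset.mul_prod_erase S b hyS, mul_comm, mul_smul]
    exact Subalgebra.smul_mem _ (hb y) _
  · rw [smul_zero]
    exact zero_mem _
  · intro x y _ _ hx hy
    rw [smul_add]
    exact add_mem hx hy
  · intro r x _ hx
    rw [smul_comm]
    exact Subalgebra.smul_mem _ hx _

omit [IsDomain R] [IsFractionRing R K] in
/-- The coordinates of an element of `R[root f]` — the coefficients of its reduced representative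
modulo the monic `f = f₀ ⊗_R K` — lie in `R`. [folklore] -/
theorem coeff_modByMonicHom_mem_range (f₀ : R[X]) (hf₀ : f₀.Monic) {f : K[X]}
    (hf : f₀.map (algebraMap R K) = f) (hfm : f.Monic) {y : AdjoinRoot f}
    (hy : y ∈ Algebra.adjoin R {AdjoinRoot.root f}) (n : ℕ) :
    (AdjoinRoot.modByMonicHom hfm y).coeff n ∈ (algebraMap R K).range := by
  rw [Algebra.adjoin_singleton_eq_range_aeval, AlgHom.mem_range] at hy
  obtain ⟨g, rfl⟩ := hy
  rw [AdjoinRoot.aeval_eq_of_algebra, AdjoinRoot.modByMonicHom_mk, ← hf,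
    ← Polynomial.map_modByMonic _ hf₀, Polynomial.coeff_map]
  exact ⟨_, rfl⟩

omit [IsDomain R] in
/-- **The key local computation (conductor of `R[α]` at a bad closed point).** Let
`f = T^p - a` over `K = Frac R` be irreducible, `α = root f`, and `s₀ ∈ R` multiply the integral
closure of `R` in `L = K[T]/(f)` into `R[α]`. If at a prime `q ∋ ϖ ≠ 0` one has
`t₂ (t₁^p a - c₀^p) = t₁^p ϖ² e₀` with `t₁, t₂ ∉ q`, then `s₀ ∈ q`: the element
`γ = t₂ (t₁ α - c₀)^{p-1} / ϖ` satisfies `γ^p = t₂ (t₁^p e₀)^{p-1} ϖ^{p-2} ∈ R`, so `s₀ γ ∈ R[α]`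
has `α^{p-1}`-coordinate `s₀ t₂ t₁^{p-1} / ϖ ∈ R`. [folklore] -/
theorem mem_of_conductor (p : ℕ) [Fact p.Prime] [CharP K p] {a : R} {f : K[X]}
    (hf : f = X ^ p - C (algebraMap R K a)) [Fact (Irreducible f)] {s₀ : R}
    (hs₀ : ∀ y ∈ integralClosure R (AdjoinRoot f), s₀ • y ∈ Algebra.adjoin R {AdjoinRoot.root f})
    {q : Ideal R} [q.IsPrime] {ϖ : R} (hϖq : ϖ ∈ q) (hϖ0 : ϖ ≠ 0) {c₀ e₀ t₁ t₂ : R}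
    (ht₁ : t₁ ∉ q) (ht₂ : t₂ ∉ q) (heq : t₂ * (t₁ ^ p * a - c₀ ^ p) = t₁ ^ p * ϖ ^ 2 * e₀) :
    s₀ ∈ q := by
  have hp : p.Prime := Fact.out
  obtain ⟨m, rfl⟩ : ∃ m, p = m + 2 := ⟨p - 2, by have := hp.two_le; omega⟩
  have hfm : f.Monic := hf ▸ monic_X_pow_sub_C _ (by omega)
  have hfdeg : f.natDegree = m + 2 := by rw [hf, natDegree_X_pow_sub_C]
  have hf0 : (X ^ (m + 2) - C a : R[X]).map (algebraMap R K) = f := by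
    rw [hf, Polynomial.map_sub, Polynomial.map_pow, map_X, map_C]
  haveI : CharP (AdjoinRoot f) (m + 2) :=
    charP_of_injective_algebraMap (algebraMap K (AdjoinRoot f)).injective _
  have hRK : Function.Injective (algebraMap R K) := IsFractionRing.injective R K
  have hRL : Function.Injective (algebraMap R (AdjoinRoot f)) := by
    rw [IsScalarTower.algebraMap_eq R K (AdjoinRoot f), RingHom.coe_comp]
    exact (algebraMap K (AdjoinRoot f)).injective.comp hRK
  -- `α^p = a`
  have hαp : AdjoinRoot.root f ^ (m + 2) = algebraMap R (AdjoinRoot f) a := by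
    have h : AdjoinRoot.mk f (X ^ (m + 2) - C (algebraMap R K a)) = 0 := by
      rw [← hf]; exact AdjoinRoot.mk_self
    rw [map_sub, map_pow, AdjoinRoot.mk_X, AdjoinRoot.mk_C, sub_eq_zero] at h
    rw [h, AdjoinRoot.algebraMap_eq', RingHom.comp_apply]
  -- `β = t₁ α - c₀` and its representative `g₁`
  obtain ⟨β, hβ⟩ : ∃ β : AdjoinRoot f,
      β = algebraMap R _ t₁ * AdjoinRoot.root f - algebraMap R _ c₀ := ⟨_, rfl⟩
  obtain ⟨g₁, hg₁⟩ : ∃ g₁ : K[X],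
      g₁ = C (algebraMap R K t₁) * X + C (-(algebraMap R K c₀)) := ⟨_, rfl⟩
  have hβg₁ : β = AdjoinRoot.mk f g₁ := by
    simp only [hβ, hg₁, map_add, map_mul, map_neg, AdjoinRoot.mk_X, AdjoinRoot.mk_C,
      AdjoinRoot.algebraMap_eq', RingHom.comp_apply, sub_eq_add_neg]
  have hβp : β ^ (m + 2) = algebraMap R (AdjoinRoot f) (t₁ ^ (m + 2) * a - c₀ ^ (m + 2)) := by
    rw [hβ, sub_pow_char, mul_pow, hαp, map_sub, map_mul, map_pow, map_pow]
  have hrel : algebraMap R (AdjoinRoot f) t₂ * β ^ (m + 2) =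
      algebraMap R _ t₁ ^ (m + 2) * algebraMap R _ ϖ ^ 2 * algebraMap R _ e₀ := by
    rw [hβp, ← map_mul, heq, map_mul, map_mul, map_pow, map_pow]
  -- `γ = t₂ β^{p-1} / ϖ` and `γ^p ∈ R`
  have hPi : algebraMap R (AdjoinRoot f) ϖ ≠ 0 := (map_ne_zero_iff _ hRL).mpr hϖ0
  obtain ⟨γ, hγ⟩ : ∃ γ : AdjoinRoot f,
      γ = algebraMap R _ t₂ * β ^ (m + 1) * (algebraMap R _ ϖ)⁻¹ := ⟨_, rfl⟩
  have hγp : γ ^ (m + 2) = algebraMap R _ (t₂ * (t₁ ^ (m + 2) * e₀) ^ (m + 1) * ϖ ^ m) := by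
    have hPip : algebraMap R (AdjoinRoot f) ϖ ^ (m + 2) ≠ 0 := pow_ne_zero _ hPi
    rw [← mul_left_inj' hPip]
    calc γ ^ (m + 2) * algebraMap R (AdjoinRoot f) ϖ ^ (m + 2)
        = (algebraMap R _ t₂ * β ^ (m + 1)) ^ (m + 2) *
            ((algebraMap R _ ϖ)⁻¹ * algebraMap R (AdjoinRoot f) ϖ) ^ (m + 2) := by
          rw [hγ]; ring
      _ = algebraMap R _ t₂ * (algebraMap R (AdjoinRoot f) t₂ * β ^ (m + 2)) ^ (m + 1) := by
          rw [inv_mul_cancel₀ hPi, one_pow, mul_one]; ring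
      _ = algebraMap R _ (t₂ * (t₁ ^ (m + 2) * e₀) ^ (m + 1) * ϖ ^ m) *
            algebraMap R (AdjoinRoot f) ϖ ^ (m + 2) := by
          rw [hrel]; simp only [map_mul, map_pow]; ring
  have hγint : γ ∈ integralClosure R (AdjoinRoot f) := by
    refine ⟨X ^ (m + 2) - C (t₂ * (t₁ ^ (m + 2) * e₀) ^ (m + 1) * ϖ ^ m),
      monic_X_pow_sub_C _ (by omega), ?_⟩
    simp only [eval₂_sub, eval₂_X_pow, eval₂_C, hγp, sub_self]
  have hmem := hs₀ γ hγint
  -- `s₀ γ = κ β^{p-1}` with `κ = s₀ t₂ / ϖ ∈ K`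
  obtain ⟨κ, hκ⟩ : ∃ κ : K,
      κ = algebraMap R K s₀ * algebraMap R K t₂ * (algebraMap R K ϖ)⁻¹ := ⟨_, rfl⟩
  have hsγ : s₀ • γ = κ • β ^ (m + 1) := by
    rw [Algebra.smul_def, Algebra.smul_def, hγ, hκ, map_mul, map_mul, map_inv₀,
      ← IsScalarTower.algebraMap_apply, ← IsScalarTower.algebraMap_apply,
      ← IsScalarTower.algebraMap_apply]
    ring
  -- the `α^{p-1}`-coordinate of `β^{p-1}` is `t₁^{p-1}`
  have hg₁deg : g₁.natDegree ≤ 1 := hg₁ ▸ natDegree_linear_le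
  have hdeg : (g₁ ^ (m + 1)).degree < f.degree := by
    apply degree_lt_degree
    rw [hfdeg]
    calc (g₁ ^ (m + 1)).natDegree ≤ (m + 1) * g₁.natDegree := natDegree_pow_le
      _ ≤ (m + 1) * 1 := Nat.mul_le_mul_left _ hg₁deg
      _ < m + 2 := by omega
  have hcoeff : (g₁ ^ (m + 1)).coeff (m + 1) = algebraMap R K t₁ ^ (m + 1) := by
    have h := coeff_pow_of_natDegree_le (m := m + 1) hg₁deg
    rw [mul_one] at h
    rw [h, hg₁]
    simp
  have hmod : AdjoinRoot.modByMonicHom hfm (s₀ • γ) = κ • g₁ ^ (m + 1) := by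
    rw [hsγ, LinearMap.map_smul, hβg₁, ← map_pow, AdjoinRoot.modByMonicHom_mk,
      (modByMonic_eq_self_iff hfm).mpr hdeg]
  obtain ⟨r, hr⟩ := coeff_modByMonicHom_mem_range (X ^ (m + 2) - C a)
    (monic_X_pow_sub_C _ (by omega)) hf0 hfm hmem (m + 1)
  rw [hmod, coeff_smul, hcoeff, smul_eq_mul, hκ] at hr
  -- hence `r ϖ = s₀ t₂ t₁^{p-1}` in `R`, so `s₀ ∈ q`
  have hϖK : algebraMap R K ϖ ≠ 0 := (map_ne_zero_iff _ hRK).mpr hϖ0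
  have h4 : r * ϖ = s₀ * t₂ * t₁ ^ (m + 1) := by
    apply hRK
    simp only [map_mul, map_pow]
    rw [hr]
    field_simp
  have h5 : s₀ * t₂ * t₁ ^ (m + 1) ∈ q := h4 ▸ q.mul_mem_left r hϖq
  rcases Ideal.IsPrime.mem_or_mem ‹q.IsPrime› h5 with h6 | h6
  · exact (Ideal.IsPrime.mem_or_mem ‹q.IsPrime› h6).resolve_right ht₂
  · exact absurd (Ideal.IsPrime.mem_of_pow_mem ‹q.IsPrime› _ h6) ht₁

end Order

/-! ## The stub -/

/-- STUB (`n ≤ 1`, A) of the line `SketchIdeator3` of crux stmt-ResolutionOfSingularities-0557 —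
**the bad locus is finite and closed-pointed**: for `R` a regular finitely generated `k`-domain
of dimension `≤ 1` (`char k = p`) and `a ∈ R ∖ R^p`, the primes `q` at which the image of `a` in
`R_q` is not in Giraud normal form with empty boundary form a finite set of non-zero primes. At a
bad prime `a ≡ c^p (mod 𝔪_q²)`; at `q = ⊥` this makes `a` a `p`-th power in `Frac R` (excluded,
`R` normal); at a bad closed point `q` the element `(t₁ α - c₀)^{p-1} t₂ / ϖ` (`α = a^{1/p}`, `ϖ`
a uniformizer) is integral over `R` but has a non-integral `α^{p-1}`-coordinate unless `q`
contains the conductor element `s₀ ≠ 0` of `R[α]` in its normalisation — finite over `R` by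
E. Noether (`NoetherFiniteIntegralClosure_holds`) — and a non-zero element of a one-dimensional
Noetherian domain lies in only finitely many non-zero primes. [folklore] -/
theorem stub_badLocusFinite : ∀ (p : ℕ), p.Prime → ∀ (k : Type) [Field k] [CharP k p]
    (R : Type) [CommRing R] [IsDomain R] [Algebra k R], Algebra.FiniteType k R → IsRegularRing R →
    ringKrullDim R ≤ 1 → ∀ a : R, (∀ b : R, b ^ p ≠ a) →
      {q : PrimeSpectrum R | ¬ GiraudNormalFormAt p
          (![] : Fin 0 → Localization.AtPrime q.asIdeal)
          (algebraMap R (Localization.AtPrime q.asIdeal) a)}.Finite ∧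
      ∀ q : PrimeSpectrum R, ¬ GiraudNormalFormAt p
          (![] : Fin 0 → Localization.AtPrime q.asIdeal)
          (algebraMap R (Localization.AtPrime q.asIdeal) a) → q.asIdeal ≠ ⊥ := by
  intro p hp k _ _ R _ _ _ hft hreg hdim a ha
  haveI : Fact p.Prime := ⟨hp⟩
  haveI := hft
  haveI := hreg
  haveI : IsIntegrallyClosed R := Negative.isIntegrallyClosed_of_isRegularRing R
  haveI : Ring.DimensionLEOne R := Ring.DimensionLEOne.of_ringKrullDim_le_one hdim
  haveI : IsDedekindRing R := {}
  have haK : ∀ c : FractionRing R, c ^ p ≠ algebraMap R (FractionRing R) a :=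
    Negative.not_pow_fractionRing p R ha
  have hRK : Function.Injective (algebraMap R (FractionRing R)) := IsFractionRing.injective R _
  -- (2) bad primes are non-zero
  have hbot : ∀ q : PrimeSpectrum R, ¬ GiraudNormalFormAt p
      (![] : Fin 0 → Localization.AtPrime q.asIdeal)
      (algebraMap R (Localization.AtPrime q.asIdeal) a) → q.asIdeal ≠ ⊥ := by
    intro q hq hq0
    have hmax : IsLocalRing.maximalIdeal (Localization.AtPrime q.asIdeal) =
        Ideal.span {algebraMap R (Localization.AtPrime q.asIdeal) 0} := by
      rw [map_zero, Ideal.span_singleton_zero, ← Localization.AtPrime.map_eq_maximalIdeal,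
        Ideal.map_eq_bot_iff_le_ker]
      exact hq0.le.trans bot_le
    obtain ⟨c₀, e₀, t₁, t₂, ht₁, ht₂, heq⟩ := exists_eq_of_sub_pow_mem_sq q.asIdeal p a 0 hmax
      (exists_sub_pow_mem_sq_of_not_giraudNormalFormAt hp.ne_zero hq)
    have ht₁0 : t₁ ≠ 0 := fun h => ht₁ (h ▸ q.asIdeal.zero_mem)
    have ht₂0 : t₂ ≠ 0 := fun h => ht₂ (h ▸ q.asIdeal.zero_mem)
    have h1 : t₁ ^ p * a = c₀ ^ p := by
      have h0 : t₂ * (t₁ ^ p * a - c₀ ^ p) = 0 := by rw [heq]; ring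
      exact sub_eq_zero.mp ((mul_eq_zero.mp h0).resolve_left ht₂0)
    have ht₁K : algebraMap R (FractionRing R) t₁ ≠ 0 := (map_ne_zero_iff _ hRK).mpr ht₁0
    refine haK (algebraMap R _ c₀ / algebraMap R _ t₁) ?_
    have h2 : algebraMap R (FractionRing R) c₀ ^ p =
        algebraMap R _ t₁ ^ p * algebraMap R _ a := by
      rw [← map_pow, ← h1, map_mul, map_pow]
    rw [div_pow, h2]
    exact mul_div_cancel_left₀ _ (pow_ne_zero _ ht₁K)
  refine ⟨?_, hbot⟩
  -- (3) the field `L = Frac(R)[T]/(T^p - a)` and the conductor element `s₀`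
  obtain ⟨f, hf⟩ : ∃ f : (FractionRing R)[X], f = X ^ p - C (algebraMap R _ a) := ⟨_, rfl⟩
  have hirr : Irreducible f := hf ▸ X_pow_sub_C_irreducible_of_prime hp haK
  haveI : Fact (Irreducible f) := ⟨hirr⟩
  haveI : Module.Finite (FractionRing R) (AdjoinRoot f) :=
    (AdjoinRoot.powerBasis hirr.ne_zero).finite
  haveI : CharP R p := charP_of_injective_algebraMap (algebraMap k R).injective p
  haveI : CharP (FractionRing R) p := charP_of_injective_algebraMap hRK p
  have hfin : Module.Finite R (integralClosure R (AdjoinRoot f)) :=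
    NoetherFiniteIntegralClosure_holds k R (FractionRing R) (AdjoinRoot f)
  have hfg : (Subalgebra.toSubmodule (integralClosure R (AdjoinRoot f))).FG := by
    rw [← Module.Finite.iff_fg]; exact hfin
  obtain ⟨s₀, hs₀0, hs₀⟩ := exists_smul_mem_adjoin_root_of_fg f hfg
  -- (4) the bad primes are among the finitely many minimal primes over `(s₀)`
  refine ((Ideal.finite_minimalPrimes_of_isNoetherianRing R (Ideal.span {s₀})).preimage
    fun q₁ _ q₂ _ h => PrimeSpectrum.ext h).subset fun q hq => ?_
  have hq0 : q.asIdeal ≠ ⊥ := hbot q hq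
  have hs₀q : s₀ ∈ q.asIdeal := by
    haveI : IsDiscreteValuationRing (Localization.AtPrime q.asIdeal) :=
      IsLocalization.AtPrime.isDiscreteValuationRing_of_dedekind_domain R hq0 _
    obtain ⟨ϖ', hϖ'⟩ :=
      IsDiscreteValuationRing.exists_irreducible (Localization.AtPrime q.asIdeal)
    rw [IsDiscreteValuationRing.irreducible_iff_uniformizer] at hϖ'
    obtain ⟨ϖ, t, hϖt⟩ : ∃ (ϖ : R) (t : q.asIdeal.primeCompl),
        ϖ' * algebraMap R _ t = algebraMap R _ ϖ :=
      let ⟨x, hx⟩ := IsLocalization.surj q.asIdeal.primeCompl ϖ'; ⟨x.1, x.2, hx⟩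
    have hmax : IsLocalRing.maximalIdeal (Localization.AtPrime q.asIdeal) =
        Ideal.span {algebraMap R (Localization.AtPrime q.asIdeal) ϖ} := by
      rw [hϖ', ← hϖt, Ideal.span_singleton_mul_right_unit (IsLocalization.map_units _ t)]
    have hϖq : ϖ ∈ q.asIdeal := by
      rw [← IsLocalization.AtPrime.to_map_mem_maximal_iff (Localization.AtPrime q.asIdeal)
        q.asIdeal ϖ, hmax]
      exact Ideal.mem_span_singleton_self _
    have hϖ0 : ϖ ≠ 0 := by
      rintro rfl
      refine IsDiscreteValuationRing.not_a_field (Localization.AtPrime q.asIdeal) ?_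
      rw [hmax, map_zero, Ideal.span_singleton_zero]
    obtain ⟨c₀, e₀, t₁, t₂, ht₁, ht₂, heq⟩ := exists_eq_of_sub_pow_mem_sq q.asIdeal p a ϖ hmax
      (exists_sub_pow_mem_sq_of_not_giraudNormalFormAt hp.ne_zero hq)
    exact mem_of_conductor p hf hs₀ hϖq hϖ0 ht₁ ht₂ heq
  refine ⟨⟨q.isPrime, (Ideal.span_singleton_le_iff_mem _).mpr hs₀q⟩, ?_⟩
  rintro P ⟨hP, hPs⟩ hPq
  have hP0 : P ≠ ⊥ := by
    rintro rfl
    exact hs₀0 (Ideal.mem_bot.mp ((Ideal.span_singleton_le_iff_mem _).mp hPs))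
  exact ((Ring.DimensionLEOne.maximalOfPrime hP0 hP).eq_of_le q.isPrime.ne_top hPq).symm.le

end Summit.ResolutionOfSingularities.ResolutionOfSingularities.Theorems.PicoverLocalModel.BadLocusFinite

end
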